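import Literature.NumberTheory.Rogawski1990.LocalHyperbolicClassIsLevi                  -- ★ `exists_mem_unitaryGroup_antidiagTwo_eigenframe_of_not_norm_one` (hyperbolic eigenframe ⇒ `U(Φ₂)`-conjugate to the torus)
import Literature.NumberTheory.Rogawski1990.LocalStableClassesNonsplitTypeOneOfCharpoly    -- ★ `exists_eigenframe_of_charpoly_eq_prod` (split separable charpoly ⇒ eigenframe)
import Literature.RingTheory.DiscreteValuationRing.AdicCompletionHensel                  -- ★ instance `HenselianLocalRing (w.adicCompletionIntegers E)`
import Mathlib.LinearAlgebra.Matrix.Charpoly.Coeff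
import HarnessLib

/-!
# F0 · P3c · line LH6 «StCharTS» — road (D) «DEEP-FL», brick HYP «RANK-ONE-HYPERBOLIC»: an element of `U(Φ₂)(E_w)` whose characteristic polynomial
# `X² − c₁X + c₂` has `|c₂|_w < |c₁|_w²` has two eigenvalues in `E_w` (Hensel, any residue characteristic) and is `U(Φ₂)(E_w)`-conjugate to the diagonal torus

Cell `pub/hodgecm-mathlib`, crux H413 = `stmt-HodgeConjecture-24833` (`--supports` lane, helper), route HCCMUnconditional; seat LH6-p04 (g2), road (D) «DEEP-FL»
(owner; desk F0P3b-plan (g23) ruling 2026-09-02T04:10:49Z (3)); interface v2 `F0/P3b/LH6-p04/g2/ROAD-D.interface.v2.txt` brick HYP — the input of D3-iii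
«OFF-STRATUM VANISHING» (a `G`-regular `γ_H = (h₂, h₁)` whose block `h₂` is NOT `U(Φ₂)`-conjugate into the diagonal torus has `|c₁(h₂)|² ≤ |c₂(h₂)|`, so — by ★ D1
«SHELL-VAL» on the block — neither the `H`-shell nor any matched `G`-shell class meets its stable class).  THEOREMS ONLY (no definition ∕ instance ∕ notation ∕ named
fact), sorry-free.  HONEST LABEL: HC_CM is proved only modulo the 7 printed citations (2 remaining: hLiu418 = stmt-HodgeConjecture-24832, h413 =
stmt-HodgeConjecture-24833) until rung 0 closes; count-neutral; elementary local algebra here.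

THE MATHEMATICS ([Rogawski1990, §3.5 p. 29 (the tori `E¹ × E¹` vs `E^×` of `U(2)`), §3.6 p. 31]; [Omeara1963, §63A] for Hensel in `E_w`).
* §1 `exists_root_sq_add_self_add_of_valued_lt` — Hensel's lemma for `Y² + Y + δ`, `|δ|_w < 1`, at the simple root `0` of its reduction: a root `y ∈ E_w` with `|y|_w < 1`
  (★ instance `HenselianLocalRing 𝒪_w`; works in EVERY residue characteristic, unlike square roots).
* §2 `exists_roots_of_valued_lt_sq` — for `c₁ ≠ 0` and `|c₂| < |c₁|²`: `X² − c₁X + c₂ = (X − λ₁)(X − λ₂)` with `λ₁ = c₁(1 + y)`, `|λ₁| = |c₁|`, `λ₂ = −c₁ y`, `|λ₂| < |c₁|`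
  (substitute `X = c₁(1 + Y)`).
* §3 `exists_mem_unitaryGroup_eigenframe_of_valued_det_lt` — **HYP**: for an involution `σ` of `E_w` preserving `|·|_w` and `γ ∈ U(σ, Φ₂)(E_w)` with
  `|det γ| < |tr γ|²`, there are `Q ∈ U(σ, Φ₂)(E_w)` and an injective `u : Fin 2 → E_w` with `γ Q = Q · diag(u)`, `|u₀| = |tr γ|`, `|u₁| < |u₀|` — `γ` is `U(Φ₂)`-conjugate to
  the diagonal torus element `Q⁻¹ γ Q = diag(u)` (★ `exists_eigenframe_of_charpoly_eq_prod` + ★ `exists_mem_unitaryGroup_antidiagTwo_eigenframe_of_not_norm_one`: the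
  eigenvalues cannot both have norm one since `|u₀ u₁| = |det γ| < |tr γ|² = |u₀|²` forces `|u₀| ≠ |u₁|` while `|σ(u)u| = |u|²`).  Contrapositive («OFF-STRATUM»): a
  `γ ∈ U(σ, Φ₂)(E_w)` admitting no unitary eigenframe has `|tr γ|² ≤ |det γ|`.

## References
* [Rogawski1990] J. D. Rogawski, *Automorphic Representations of Unitary Groups in Three Variables*, Ann. of Math. Stud. 123 (1990), §3.5 p. 29, §3.6 p. 31.
* [Omeara1963] O. T. O'Meara, *Introduction to Quadratic Forms*, Grundlehren 117 (1963), §63A (local squares ∕ Hensel).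
* [Scharlau1985HermitianForms] W. Scharlau, *Quadratic and Hermitian Forms*, Grundlehren 270 (1985), Ch. 7 §6.
-/

set_option autoImplicit false
-- the mandated namespace has the single-problem summit's repeated segment (`HodgeConjecture.HodgeConjecture`)
set_option linter.dupNamespace false

noncomputable section

open Matrix Polynomial NumberField IsDedekindDomain
open scoped MatrixGroups Valued

namespace Summit.HodgeConjecture.HodgeConjecture.Cruxes.H413.F0P3cStCharTSRankOneHyp

open Literature.NumberTheory.Rogawski1990 Literature.NumberTheory.Automorphic Literature.NumberTheory.Automorphic.UnitaryGroup
open Literature.AlgebraicGeometry.ShimuraVarieties (unitaryGroup)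

variable {E : Type*} [Field E] [NumberField E]

/-! ## §1 Hensel for `Y² + Y + δ` -/

/-- **Hensel's lemma for `Y² + Y + δ`, `|δ|_w < 1`**: a root `y ∈ E_w` with `|y|_w < 1` (the reduction has the simple root `0`: value `δ ∈ 𝔪_w`, derivative `1`).
Valid in every residue characteristic. [cite: Omeara1963, §63A] -/
theorem exists_root_sq_add_self_add_of_valued_lt (w : HeightOneSpectrum (𝓞 E)) (δ : w.adicCompletion E) (hδ : Valued.v δ < 1) :
    ∃ y : w.adicCompletion E, y ^ 2 + y + δ = 0 ∧ Valued.v y < 1 := by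
  haveI : HenselianLocalRing 𝒪[w.adicCompletion E] :=
    inferInstanceAs (HenselianLocalRing (w.adicCompletionIntegers E))
  have hint : (Valued.v (R := w.adicCompletion E)).Integers 𝒪[w.adicCompletion E] :=
    Valuation.integer.integers _
  have hδ1 : δ ∈ 𝒪[w.adicCompletion E] := (Valuation.mem_integer_iff _ _).2 hδ.le
  obtain ⟨δ', hδ'⟩ : ∃ δ' : 𝒪[w.adicCompletion E], (δ' : w.adicCompletion E) = δ := ⟨⟨δ, hδ1⟩, rfl⟩
  have hmem : ∀ x : 𝒪[w.adicCompletion E], x ∈ IsLocalRing.maximalIdeal 𝒪[w.adicCompletion E] ↔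
      Valued.v (x : w.adicCompletion E) < 1 := by
    intro x
    rw [IsLocalRing.mem_maximalIdeal, mem_nonunits_iff, hint.isUnit_iff_valuation_eq_one]
    exact ⟨fun h => lt_of_le_of_ne x.2 h, fun h => ne_of_lt h⟩
  have hmonic : (X ^ 2 + X + C δ').Monic := by
    have : (X ^ 2 + X + C δ' : (𝒪[w.adicCompletion E])[X]) = X ^ 2 + (X + C δ') := by ring
    rw [this]
    exact monic_X_pow_add (by
      refine (degree_add_le _ _).trans_lt (max_lt ?_ ?_)
      · exact degree_X_le.trans_lt (by norm_num)
      · exact degree_C_le.trans_lt (by norm_num))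
  have he1 : (X ^ 2 + X + C δ').eval 0 = δ' := by
    rw [eval_add, eval_add, eval_pow, eval_X, eval_C]
    ring
  have he2 : (derivative (X ^ 2 + X + C δ')).eval 0 = 1 := by
    rw [derivative_add, derivative_add, derivative_C, derivative_X_pow, derivative_X, eval_add, eval_add, eval_mul, eval_C, eval_pow, eval_X]
    norm_num
  have h1 : (X ^ 2 + X + C δ').eval 0 ∈ IsLocalRing.maximalIdeal 𝒪[w.adicCompletion E] := by
    rw [he1, hmem, hδ']
    exact hδ
  have h2 : IsUnit ((derivative (X ^ 2 + X + C δ')).eval 0) := by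
    rw [he2]
    exact isUnit_one
  obtain ⟨a, ha, ha1⟩ := HenselianLocalRing.is_henselian (X ^ 2 + X + C δ') hmonic 0 h1 h2
  refine ⟨(a : w.adicCompletion E), ?_, ?_⟩
  · have h : a ^ 2 + a + δ' = 0 := by
      rwa [IsRoot.def, eval_add, eval_add, eval_pow, eval_X, eval_C] at ha
    have := congrArg (fun x : 𝒪[w.adicCompletion E] => (x : w.adicCompletion E)) h
    simpa [hδ'] using this
  · have := (hmem _).1 (by simpa using ha1)
    exact this

/-! ## §2 The two roots of `X² − c₁X + c₂` when `|c₂| < |c₁|²` -/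

/-- **The roots of `X² − c₁X + c₂` for `|c₂|_w < |c₁|_w²**: `λ₁ + λ₂ = c₁`, `λ₁λ₂ = c₂`, `|λ₁| = |c₁|`, `|λ₂| < |c₁|` (so `λ₁ ≠ λ₂`) — substitute `X = c₁(1 + Y)` and solve
`Y² + Y + c₂/c₁² = 0` by §1. [cite: Omeara1963, §63A] [cite: Rogawski1990, §3.6 p. 31] -/
theorem exists_roots_of_valued_lt_sq (w : HeightOneSpectrum (𝓞 E)) (c₁ c₂ : w.adicCompletion E) (hc₁ : c₁ ≠ 0)
    (h : Valued.v c₂ < Valued.v c₁ ^ 2) :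
    ∃ l₁ l₂ : w.adicCompletion E, l₁ + l₂ = c₁ ∧ l₁ * l₂ = c₂ ∧ Valued.v l₁ = Valued.v c₁ ∧ Valued.v l₂ < Valued.v c₁ := by
  have hv₁ : Valued.v c₁ ≠ 0 := (Valuation.ne_zero_iff _).2 hc₁
  have hc₁2 : c₁ ^ 2 ≠ 0 := pow_ne_zero 2 hc₁
  set δ : w.adicCompletion E := c₂ / c₁ ^ 2 with hδdef
  have hδ : Valued.v δ < 1 := by
    rw [hδdef, Valuation.map_div, Valuation.map_pow, div_lt_iff₀ (pow_pos (zero_lt_iff.2 hv₁) 2), one_mul]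
    exact h
  obtain ⟨y, hy, hyv⟩ := exists_root_sq_add_self_add_of_valued_lt w δ hδ
  refine ⟨c₁ * (1 + y), -(c₁ * y), by ring, ?_, ?_, ?_⟩
  · -- `c₁(1+y) · (−c₁ y) = −c₁²(y + y²) = c₁² δ = c₂`
    have hy' : y ^ 2 + y = -δ := by linear_combination hy
    calc c₁ * (1 + y) * -(c₁ * y) = -(c₁ ^ 2) * (y ^ 2 + y) := by ring
      _ = c₁ ^ 2 * δ := by rw [hy']; ring
      _ = c₂ := by rw [hδdef]; field_simp
  · rw [Valuation.map_mul, Valuation.map_one_add_of_lt _ hyv, mul_one]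
  · rw [Valuation.map_neg, Valuation.map_mul]
    calc Valued.v c₁ * Valued.v y < Valued.v c₁ * 1 := mul_lt_mul_of_pos_left hyv (zero_lt_iff.2 hv₁)
      _ = Valued.v c₁ := mul_one _

/-! ## §3 HYP: `|det γ| < |tr γ|²` ⇒ `γ ∈ U(σ, Φ₂)(E_w)` is `U(Φ₂)`-conjugate to the diagonal torus -/

/-- **HYP «RANK-ONE-HYPERBOLIC».**  Let `σ` be an involution of `E_w` preserving `|·|_w` and `γ ∈ U(σ, Φ₂)(E_w)` (`Φ₂ = antidiag(1,1)`) with `|det γ|_w < |tr γ|_w²`.  Then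
`γ` has an eigenframe INSIDE the unitary group: `Q ∈ U(σ, Φ₂)(E_w)`, `u : Fin 2 → E_w` injective, `γ Q = Q · diag(u)`, with `|u₀| = |tr γ|`, `|u₁| < |u₀|` — i.e.
`Q⁻¹ γ Q = diag(u₀, u₁)` lies in the diagonal torus `E^× ↪ U(1,1)` (the pair is hyperbolic, `σ(u₀) u₁ = 1`).
[cite: Rogawski1990, §3.5 p. 29; §3.6 p. 31] [cite: Omeara1963, §63A] -/
theorem exists_mem_unitaryGroup_eigenframe_of_valued_det_lt (w : HeightOneSpectrum (𝓞 E)) (σ : w.adicCompletion E →+* w.adicCompletion E)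
    (hσ : ∀ r, σ (σ r) = r) (hσv : ∀ x, Valued.v (σ x) = Valued.v x)
    {γ : GL (Fin 2) (w.adicCompletion E)}
    (hγ : γ ∈ unitaryGroup σ (Matrix.of fun i j : Fin 2 => if i.val + j.val + 1 = 2 then (1 : w.adicCompletion E) else 0))
    (hval : Valued.v (γ.val.det) < Valued.v (γ.val.trace) ^ 2) :
    ∃ (Q : GL (Fin 2) (w.adicCompletion E)) (u : Fin 2 → w.adicCompletion E),
      Q ∈ unitaryGroup σ (Matrix.of fun i j : Fin 2 => if i.val + j.val + 1 = 2 then (1 : w.adicCompletion E) else 0) ∧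
      Function.Injective u ∧ γ.val * Q.val = Q.val * diagonal u ∧
      Valued.v (u 0) = Valued.v γ.val.trace ∧ Valued.v (u 1) < Valued.v (u 0) ∧ σ (u 0) * u 1 = 1 := by
  have htr : γ.val.trace ≠ 0 := fun h0 => by
    rw [h0, Valuation.map_zero, zero_pow two_ne_zero] at hval
    exact not_lt_of_ge zero_le hval
  obtain ⟨l₁, l₂, hsum, hprod, hv1, hv2⟩ := exists_roots_of_valued_lt_sq w γ.val.trace γ.val.det htr hval
  -- the split characteristic polynomial and the eigenframe
  have hne : l₁ ≠ l₂ := fun h => by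
    have h' : Valued.v l₂ = Valued.v γ.val.trace := by rw [← h]; exact hv1
    rw [h'] at hv2
    exact lt_irrefl _ hv2
  set u : Fin 2 → w.adicCompletion E := ![l₁, l₂] with hu
  have hinj : Function.Injective u := by
    intro i j hij
    fin_cases i <;> fin_cases j
    · rfl
    · exact absurd hij (by simpa [hu] using hne)
    · exact absurd hij (by simpa [hu] using hne.symm)
    · rfl
  have hchar : γ.val.charpoly = ∏ i, (X - C (u i)) := by
    rw [Matrix.charpoly_fin_two, Fin.prod_univ_two]
    simp only [hu, cons_val_zero, cons_val_one]
    rw [← hsum, ← hprod, map_add, map_mul]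
    ring
  obtain ⟨P, hP⟩ := exists_eigenframe_of_charpoly_eq_prod γ u hinj hchar
  -- not both of norm one: `|u₀| ≠ |u₁|`
  have hnot : ¬ ∀ i, σ (u i) * u i = 1 := by
    intro hall
    have hsq : ∀ i, Valued.v (u i) * Valued.v (u i) = 1 := fun i => by
      have := congrArg Valued.v (hall i)
      rwa [Valuation.map_mul, hσv, Valuation.map_one] at this
    have hlt : Valued.v (u 1) < Valued.v (u 0) := by
      simp only [hu, cons_val_zero, cons_val_one]
      rw [hv1]; exact hv2
    have hdet : γ.val.det ≠ 0 := ((Matrix.isUnit_iff_isUnit_det _).1 γ.isUnit).ne_zero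
    have hl₂ : l₂ ≠ 0 := fun h0 => hdet (by rw [← hprod, h0, mul_zero])
    have hpos1 : 0 < Valued.v (u 1) := by
      simp only [hu, cons_val_one]
      exact zero_lt_iff.2 ((Valuation.ne_zero_iff _).2 hl₂)
    have hpos0 : 0 < Valued.v (u 0) := lt_trans hpos1 hlt
    have : Valued.v (u 1) * Valued.v (u 1) < Valued.v (u 0) * Valued.v (u 0) :=
      calc Valued.v (u 1) * Valued.v (u 1) < Valued.v (u 1) * Valued.v (u 0) := mul_lt_mul_of_pos_left hlt hpos1
        _ < Valued.v (u 0) * Valued.v (u 0) := mul_lt_mul_of_pos_right hlt hpos0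
    rw [hsq 1, hsq 0] at this
    exact lt_irrefl _ this
  obtain ⟨⟨h01, -⟩, Q, hQ, hQP⟩ := exists_mem_unitaryGroup_antidiagTwo_eigenframe_of_not_norm_one σ hσ hγ hP hinj hnot
  refine ⟨Q, u, hQ, hinj, hQP, ?_, ?_, h01⟩
  · simp only [hu, cons_val_zero]; exact hv1
  · simp only [hu, cons_val_zero, cons_val_one]; rw [hv1]; exact hv2

/-- **OFF-STRATUM (contrapositive of HYP)**: `γ ∈ U(σ, Φ₂)(E_w)` with NO unitary eigenframe (i.e. not `U(Φ₂)`-conjugate into the diagonal torus with distinct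
eigenvalues) satisfies `|tr γ|_w² ≤ |det γ|_w` — in particular its characteristic polynomial does not have the shell pattern `|c₂| < |c₁|²` of ★ D1.
[cite: Rogawski1990, §3.5 p. 29; §3.6 p. 31] -/
theorem valued_trace_sq_le_det_of_not_exists_eigenframe (w : HeightOneSpectrum (𝓞 E)) (σ : w.adicCompletion E →+* w.adicCompletion E)
    (hσ : ∀ r, σ (σ r) = r) (hσv : ∀ x, Valued.v (σ x) = Valued.v x)
    {γ : GL (Fin 2) (w.adicCompletion E)}
    (hγ : γ ∈ unitaryGroup σ (Matrix.of fun i j : Fin 2 => if i.val + j.val + 1 = 2 then (1 : w.adicCompletion E) else 0))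
    (hno : ¬ ∃ (Q : GL (Fin 2) (w.adicCompletion E)) (u : Fin 2 → w.adicCompletion E),
      Q ∈ unitaryGroup σ (Matrix.of fun i j : Fin 2 => if i.val + j.val + 1 = 2 then (1 : w.adicCompletion E) else 0) ∧
      Function.Injective u ∧ γ.val * Q.val = Q.val * diagonal u) :
    Valued.v (γ.val.trace) ^ 2 ≤ Valued.v (γ.val.det) := by
  by_contra hlt
  rw [not_le] at hlt
  obtain ⟨Q, u, hQ, hinj, hQP, -, -, -⟩ := exists_mem_unitaryGroup_eigenframe_of_valued_det_lt w σ hσ hσv hγ hlt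
  exact hno ⟨Q, u, hQ, hinj, hQP⟩

end Summit.HodgeConjecture.HodgeConjecture.Cruxes.H413.F0P3cStCharTSRankOneHyp
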